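/-
Copyright (c) 2026 the pub-hodgecm-mathlib formalisation cell (harness21).  Prover seat hodgecm-mathlib-LH4-p14 (g2), req620 Track A «(D-RAM) FOUR-FRAME» squad
(unit U3_Laws, MS ROAD A Stage B; B10-facing adapters of brick B8 «THE SUM» for the assembly of `F0/P3c/LH4/LH4-p10/g2/SPEC-StageB.v1.LH4p10g2.md` (Stage B lead LH4-p10 (g2)),
MS first seat LH4-p11 (g0), dealer LH4-plan (g10∕g11)).  2026-09-03∕04.
-/
import Summits.HodgeConjecture.HodgeConjecture.Theorems.F0P3cDyRamStableCountSum   -- ★ p855676∕p855685 (this seat): `stableCountSum_mul_ring` — «THE SUM» in (m, m, L) normal form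
import HarnessLib

/-!
# Crux `H413`, line LH4 «(D-RAM) FOUR-FRAME» road — unit U3_Laws (iii), MS ROAD A, Stage B brick B8 «THE SUM», PART 2: B10-FACING ADAPTERS —
# the class sum PLANE BY PLANE (isoceles key in datum order) and TYPE 0 IN BOX COORDINATES (`r = 2ρ`, the monomials of SPEC-StageB v1 §C verbatim)

Cell `hodgecm-mathlib` (D-0151), FLOOR 0, crux item H413 = `stmt-HodgeConjecture-24833`, route of record `HCCMUnconditional`; squad F0∕P3c∕LH4 (req618∕req620).  THEOREMS ONLY
(no `def`, no instance, no notation, no `sorry`, default heartbeats); lane `--supports stmt-HodgeConjecture-24833 --as helper` (count-neutral).  Companion of ★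
`Theorems/F0P3cDyRamStableCountSum.lean` (B8: `(x − 1)·N(m, L, d, P) = x^{(2m+L−d+2)/2} − 1` for the SORTED key `(m, m, L)`).  The Stage-B assembly B10
(`F0/P3c/LH4/LH4-p10/g2/SPEC-StageB.v1.LH4p10g2.md` §C, «Σ over strata (B4–B7) = the inline class sum of B8 with m := min nᵢ, L := max nᵢ») receives the per-stratum
contributions PLANE BY PLANE for the key `(n₁, n₂, n₃) = (v(β−1), v(α−1), v(α−β))` in DATUM ORDER, indexed by the HNF box parameter `ρ = b` (`r = 2ρ` at type 0); this file does
that bookkeeping once, here, so B10 quotes an identity in its own coordinates: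
* `stableCountSum_planes` ∕ `stableCountSum_planes_of_shift` — for an ISOCELES key (`(n₁ = n₂ ≤ n₃) ∨ (n₁ = n₃ ≤ n₂) ∨ (n₂ = n₃ ≤ n₁)`, the ultrametric shape), `nᵢ ≡ d (2)`,
  `1 ≤ d ≤ min nᵢ`, any parity index `P ∈ {0,1}`: core + `Σᵢ T(nᵢ)` + `Σᵢ G(nᵢ; min_{j≠i} n_j)` + glue`(min, max)` + `H(min)` satisfies `(x−1)·N = x^{(n₁+n₂+n₃−d+2)/2} − 1`
  (resp. `= q^k − 1` under `2k + d = n₁ + n₂ + n₃ + 2`) — the three isoceles cases are the three sortings into B8's normal form;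
* `stableCountSum_planes_typeZero_box` ∕ `…_of_shift` — TYPE 0 with the outer indices re-written `r = 2ρ` (no parity filters left on `ρ`): split strata `Σ_{2≤s≤nᵢ, s even} x^{s/2}`,
  glued tubes `Σ_{1≤ρ≤⌊min_{j≠i}n_j/2⌋} Σ_{2≤s≤nᵢ−2ρ, s even} (x−1)x^{2ρ+s/2−1}`, glue shells `Σ_{1≤ρ≤m, m<2ρ, 2ρ−m≤m−d+1} x^{2ρ+(L−m)/2−⌈(2ρ−m)/2⌉}`, hanging `Σ_{1≤ρ≤⌊m/2⌋}(x−2)x^{2ρ−1}`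
  — exactly the monomials and side conditions of SPEC §C (B4 `q^(s/2)`, `2 ∣ s`, `2 ≤ s ≤ n_i`; B5 `(q−1)q^(2ρ+s/2−1)`, `2ρ + s ≤ n_i`, `2ρ ≤ min_{j≠i} n_j`; B6; B7);
* `sum_filter_even_eq_sum_twice(')` — the re-indexing lemma `Σ_{a≤r≤b, r even, p r} f r = Σ_{⌈a/2⌉≤ρ≤⌊b/2⌋, p(2ρ)} f(2ρ)`;
* `stableCountSum_planes_typeTwo_box` ∕ `…_of_shift` (§8, ED. 2) — TYPE 2 with `r = 2ρ + 1`, `ρ = b = (r−1)/2 ≥ 0` (MEMO v2.1 §T2.1–T2.3): on-branch `Σ_{1≤s≤nᵢ, s odd} x^{⌊s/2⌋}`,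
  tubes `Σ_{ρ≥0, 2ρ+1≤min_{j≠i}n_j} Σ_{2≤s≤nᵢ−(2ρ+1), s even} (x−1)x^{2ρ+s/2}`, glue `x^{2ρ+1+(L−m)/2−⌈(2ρ+1−m)/2⌉}` (`m<2ρ+1≤2m`, `2ρ+1−m≤m−d+1`), hanging `(x−2)x^{2ρ}` (`2ρ+1≤m`), NO core;
  + `sum_filter_odd_eq_sum_twice_add_one`.  Transcription re-checked numerically at home (`F0/P3c/LH4/LH4-p14/g2/t2box_check.py`, 4 410 keys, 0 failures).
HONEST LABEL.  Count-neutral (`--supports`); finite-sum bookkeeping, nothing printed is asserted; (MS) stays a PROVER TARGET until B2–B7∕B9∕B10 land; `HC_CM` is proved only modulo the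
7 printed citations (2 remaining named inputs: hLiu418 = `stmt-HodgeConjecture-24832`, h413 = `stmt-HodgeConjecture-24833`) until rung 0 closes.

## References
* [Rogawski1990] J. D. Rogawski, *Automorphic Representations of Unitary Groups in Three Variables*, Ann. of Math. Stud. 123 (1990), §4.9 Prop. 4.9.1 (a) p. 55.
* [Serre1980Trees] J.-P. Serre, *Trees*, Springer (1980), Ch. II §1.1.
-/

set_option autoImplicit false

namespace Summit.HodgeConjecture.HodgeConjecture.Cruxes.H413.F0P3cDyRamStableCountSumPlanes

open Finset
open Summit.HodgeConjecture.HodgeConjecture.Cruxes.H413.F0P3cDyRamStableCountSum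

/-! ## §6  PER-PLANE SYMMETRIC FORM (B10-facing adapter): the strata come plane by plane, before anyone chooses which plane is special -/

section Planes

variable {R : Type*} [CommRing R]

/-- **«THE SUM», PER-PLANE SYMMETRIC FORM.**  For a key `(n₁, n₂, n₃)` in DATUM ORDER that is ISOCELES (two depths equal and not larger than the third — the ultrametric shape of
`(v(β−1), v(α−1), v(α−β))`), all `nᵢ ≡ d (mod 2)`, `1 ≤ d ≤ min nᵢ`, and `P ∈ {0,1}`: the class sum written PLANE BY PLANE — core `[P=0]`, on-branch `T(nᵢ)` for each plane,
tube `G(nᵢ; min_{j≠i} n_j)` for each plane (outer index `r ≤ min_{j≠i} n_j`, inner `r + s ≤ nᵢ`), the glue shells over `(min, max)` and the hanging classes over `min` — satisfies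
`(x − 1)·N = x^{(n₁+n₂+n₃−d+2)/2} − 1`.  This is `stableCountSum_mul_ring` after sorting the key as `(m, m, L)`; the three isoceles cases are the three sortings. [cite: Rogawski1990, §4.9 Prop. 4.9.1 (a) p. 55] -/
theorem stableCountSum_planes (x : R) {d n₁ n₂ n₃ P : ℕ} (hP : P ≤ 1) (hd : 1 ≤ d)
    (hiso : (n₁ = n₂ ∧ n₁ ≤ n₃) ∨ (n₁ = n₃ ∧ n₁ ≤ n₂) ∨ (n₂ = n₃ ∧ n₂ ≤ n₁))
    (hdn : d ≤ min n₁ (min n₂ n₃)) (h1 : n₁ % 2 = d % 2) (h2 : n₂ % 2 = d % 2) (h3 : n₃ % 2 = d % 2) :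
    (x - 1) *
      ((if P = 0 then (1 : R) else 0)
        + ∑ s ∈ (Icc 1 n₁).filter (fun s => s % 2 = P), x ^ (s / 2)
        + ∑ s ∈ (Icc 1 n₂).filter (fun s => s % 2 = P), x ^ (s / 2)
        + ∑ s ∈ (Icc 1 n₃).filter (fun s => s % 2 = P), x ^ (s / 2)
        + ∑ r ∈ (Icc 1 (min n₂ n₃)).filter (fun r => r % 2 = P),
            ∑ s ∈ (Icc 2 (n₁ - r)).filter (fun s => s % 2 = 0), (x - 1) * x ^ (r + s / 2 - 1)
        + ∑ r ∈ (Icc 1 (min n₁ n₃)).filter (fun r => r % 2 = P),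
            ∑ s ∈ (Icc 2 (n₂ - r)).filter (fun s => s % 2 = 0), (x - 1) * x ^ (r + s / 2 - 1)
        + ∑ r ∈ (Icc 1 (min n₁ n₂)).filter (fun r => r % 2 = P),
            ∑ s ∈ (Icc 2 (n₃ - r)).filter (fun s => s % 2 = 0), (x - 1) * x ^ (r + s / 2 - 1)
        + ∑ r ∈ (Icc (min n₁ (min n₂ n₃) + 1) (2 * min n₁ (min n₂ n₃))).filter
              (fun r => r % 2 = P ∧ r - min n₁ (min n₂ n₃) ≤ min n₁ (min n₂ n₃) - d + 1),
            x ^ (r + (max n₁ (max n₂ n₃) - min n₁ (min n₂ n₃)) / 2 - (r - min n₁ (min n₂ n₃) + 1) / 2)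
        + ∑ r ∈ (Icc 1 (min n₁ (min n₂ n₃))).filter (fun r => r % 2 = P), (x - 2) * x ^ (r - 1))
      = x ^ ((n₁ + n₂ + n₃ - d + 2) / 2) - 1 := by
  rcases hiso with ⟨h12, h13⟩ | ⟨h13, h12⟩ | ⟨h23, h21⟩
  · subst h12
    have e1 : min n₁ n₃ = n₁ := min_eq_left h13
    have e2 : min n₁ n₁ = n₁ := min_self n₁
    have e3 : min n₁ (min n₁ n₃) = n₁ := by rw [e1, e2]
    have e4 : max n₁ (max n₁ n₃) = n₃ := by rw [max_eq_right h13, max_eq_right h13]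
    have e5 : (n₁ + n₁ + n₃ - d + 2) / 2 = (2 * n₁ + n₃ - d + 2) / 2 := by rw [two_mul]
    simp only [e1, e2, e4, e5]
    have h := stableCountSum_mul_ring x hP hd (le_trans hdn (by rw [e3])) h13 h1 (by rw [h3, h1])
    linear_combination h
  · subst h13
    have e1 : min n₂ n₁ = n₁ := min_eq_right h12
    have e2 : min n₁ n₁ = n₁ := min_self n₁
    have e3 : min n₁ n₂ = n₁ := min_eq_left h12
    have e4 : min n₁ (min n₂ n₁) = n₁ := by rw [e1, e2]
    have e5 : max n₁ (max n₂ n₁) = n₂ := by rw [max_eq_left h12, max_eq_right h12]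
    have e6 : (n₁ + n₂ + n₁ - d + 2) / 2 = (2 * n₁ + n₂ - d + 2) / 2 := by
      congr 1; omega
    simp only [e1, e2, e3, e5, e6]
    have h := stableCountSum_mul_ring x hP hd (le_trans hdn (by rw [e4])) h12 h1 (by rw [h2, h1])
    linear_combination h
  · subst h23
    have e1 : min n₂ n₂ = n₂ := min_self n₂
    have e2 : min n₁ n₂ = n₂ := min_eq_right h21
    have e4 : min n₁ (min n₂ n₂) = n₂ := by rw [e1, e2]
    have e5 : max n₁ (max n₂ n₂) = n₁ := by rw [max_self, max_eq_left h21]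
    have e6 : (n₁ + n₂ + n₂ - d + 2) / 2 = (2 * n₂ + n₁ - d + 2) / 2 := by
      congr 1; omega
    simp only [e1, e2, e5, e6]
    have h := stableCountSum_mul_ring x hP hd (le_trans hdn (by rw [e4])) h21 h2 (by rw [h1, h2])
    linear_combination h

/-- **PER-PLANE FORM with the shift hypothesis** `2k + d = n₁ + n₂ + n₃ + 2` of `stub_U3_stableModelSum` (`q : ℕ` cast to `ℚ`, no hypothesis on `q`): `(q − 1)·N = q^k − 1`.
[cite: Rogawski1990, §4.9 Prop. 4.9.1 (a) p. 55] -/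
theorem stableCountSum_planes_of_shift (q : ℕ) {d n₁ n₂ n₃ P k : ℕ} (hP : P ≤ 1) (hd : 1 ≤ d)
    (hiso : (n₁ = n₂ ∧ n₁ ≤ n₃) ∨ (n₁ = n₃ ∧ n₁ ≤ n₂) ∨ (n₂ = n₃ ∧ n₂ ≤ n₁))
    (hdn : d ≤ min n₁ (min n₂ n₃)) (h1 : n₁ % 2 = d % 2) (h2 : n₂ % 2 = d % 2) (h3 : n₃ % 2 = d % 2)
    (hk : 2 * k + d = n₁ + n₂ + n₃ + 2) :
    ((q : ℚ) - 1) *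
      ((if P = 0 then (1 : ℚ) else 0)
        + ∑ s ∈ (Icc 1 n₁).filter (fun s => s % 2 = P), (q : ℚ) ^ (s / 2)
        + ∑ s ∈ (Icc 1 n₂).filter (fun s => s % 2 = P), (q : ℚ) ^ (s / 2)
        + ∑ s ∈ (Icc 1 n₃).filter (fun s => s % 2 = P), (q : ℚ) ^ (s / 2)
        + ∑ r ∈ (Icc 1 (min n₂ n₃)).filter (fun r => r % 2 = P),
            ∑ s ∈ (Icc 2 (n₁ - r)).filter (fun s => s % 2 = 0), ((q : ℚ) - 1) * (q : ℚ) ^ (r + s / 2 - 1)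
        + ∑ r ∈ (Icc 1 (min n₁ n₃)).filter (fun r => r % 2 = P),
            ∑ s ∈ (Icc 2 (n₂ - r)).filter (fun s => s % 2 = 0), ((q : ℚ) - 1) * (q : ℚ) ^ (r + s / 2 - 1)
        + ∑ r ∈ (Icc 1 (min n₁ n₂)).filter (fun r => r % 2 = P),
            ∑ s ∈ (Icc 2 (n₃ - r)).filter (fun s => s % 2 = 0), ((q : ℚ) - 1) * (q : ℚ) ^ (r + s / 2 - 1)
        + ∑ r ∈ (Icc (min n₁ (min n₂ n₃) + 1) (2 * min n₁ (min n₂ n₃))).filter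
              (fun r => r % 2 = P ∧ r - min n₁ (min n₂ n₃) ≤ min n₁ (min n₂ n₃) - d + 1),
            (q : ℚ) ^ (r + (max n₁ (max n₂ n₃) - min n₁ (min n₂ n₃)) / 2 - (r - min n₁ (min n₂ n₃) + 1) / 2)
        + ∑ r ∈ (Icc 1 (min n₁ (min n₂ n₃))).filter (fun r => r % 2 = P), ((q : ℚ) - 2) * (q : ℚ) ^ (r - 1))
      = (q : ℚ) ^ k - 1 := by
  have h := stableCountSum_planes (q : ℚ) hP hd hiso hdn h1 h2 h3
  have hk' : (n₁ + n₂ + n₃ - d + 2) / 2 = k := by omega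
  rw [hk'] at h
  exact h

end Planes


/-! ## §7  TYPE 0 IN BOX COORDINATES (B10-facing adapter): `r = 2ρ`, no parity filter on the outer indices — the monomials of SPEC-StageB v1 §C verbatim -/

section Box

variable {R : Type*} [CommRing R]

/-- Re-indexing an even-filtered interval sum by `r = 2ρ`: `Σ_{a ≤ r ≤ b, r even, p r} f r = Σ_{⌈a/2⌉ ≤ ρ ≤ ⌊b/2⌋, p (2ρ)} f (2ρ)`. [folklore] -/
theorem sum_filter_even_eq_sum_twice (f : ℕ → R) (p : ℕ → Prop) [DecidablePred p] (a b : ℕ) :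
    ∑ r ∈ (Icc a b).filter (fun r => r % 2 = 0 ∧ p r), f r
      = ∑ ρ ∈ (Icc ((a + 1) / 2) (b / 2)).filter (fun ρ => p (2 * ρ)), f (2 * ρ) := by
  have hinj : Set.InjOn (fun ρ : ℕ => 2 * ρ) ↑((Icc ((a + 1) / 2) (b / 2)).filter (fun ρ => p (2 * ρ))) := by
    intro u _ v _ huv
    have : 2 * u = 2 * v := huv
    omega
  rw [← sum_image hinj]
  refine sum_congr ?_ fun _ _ => rfl
  ext r
  simp only [mem_filter, mem_Icc, mem_image]
  constructor
  · rintro ⟨⟨h1, h2⟩, h3, h4⟩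
    refine ⟨r / 2, ⟨⟨by omega, by omega⟩, ?_⟩, by omega⟩
    have hr : 2 * (r / 2) = r := by omega
    rw [hr]; exact h4
  · rintro ⟨ρ, ⟨⟨h1, h2⟩, h3⟩, rfl⟩
    exact ⟨⟨by omega, by omega⟩, by omega, h3⟩

/-- The plain case: `Σ_{a ≤ r ≤ b, r even} f r = Σ_{⌈a/2⌉ ≤ ρ ≤ ⌊b/2⌋} f (2ρ)`. [folklore] -/
theorem sum_filter_even_eq_sum_twice' (f : ℕ → R) (a b : ℕ) :
    ∑ r ∈ (Icc a b).filter (fun r => r % 2 = 0), f r = ∑ ρ ∈ Icc ((a + 1) / 2) (b / 2), f (2 * ρ) := by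
  have h := sum_filter_even_eq_sum_twice f (fun _ => True) a b
  simp only [and_true, filter_true_of_mem (fun _ _ => trivial)] at h
  exact h

/-- **«THE SUM», TYPE 0, PER PLANE, IN BOX COORDINATES** (the exact monomials and index conditions of SPEC-StageB v1 §C, LH4-p10 (g2)): for an isoceles key `(n₁,n₂,n₃)` in datum order,
`nᵢ ≡ d (mod 2)`, `1 ≤ d ≤ m := min nᵢ`, `L := max nᵢ`:
`(x−1)·[ 1 + Σ_i Σ_{2≤s≤nᵢ, s even} x^{s/2} + Σ_i Σ_{1≤ρ≤⌊min_{j≠i} n_j/2⌋} Σ_{2≤s≤nᵢ−2ρ, s even} (x−1)x^{2ρ+s/2−1} + Σ_{1≤ρ≤m, m<2ρ, 2ρ−m≤m−d+1} x^{2ρ+(L−m)/2−⌈(2ρ−m)/2⌉} + Σ_{1≤ρ≤⌊m/2⌋} (x−2)x^{2ρ−1} ]`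
`= x^{(n₁+n₂+n₃−d+2)/2} − 1` — core · split strata `T_i(s)` (B4) · glued tubes `G_i(ρ,s)` (B5) · glue shells ∕ equilateral hanging-glue (B6∕B7) · hanging `H(ρ)` (B7).  From `stableCountSum_planes`
at `P = 0` by `r = 2ρ`. [cite: Rogawski1990, §4.9 Prop. 4.9.1 (a) p. 55] -/
theorem stableCountSum_planes_typeZero_box (x : R) {d n₁ n₂ n₃ : ℕ} (hd : 1 ≤ d)
    (hiso : (n₁ = n₂ ∧ n₁ ≤ n₃) ∨ (n₁ = n₃ ∧ n₁ ≤ n₂) ∨ (n₂ = n₃ ∧ n₂ ≤ n₁))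
    (hdn : d ≤ min n₁ (min n₂ n₃)) (h1 : n₁ % 2 = d % 2) (h2 : n₂ % 2 = d % 2) (h3 : n₃ % 2 = d % 2) :
    (x - 1) *
      (1
        + ∑ s ∈ (Icc 2 n₁).filter (fun s => s % 2 = 0), x ^ (s / 2)
        + ∑ s ∈ (Icc 2 n₂).filter (fun s => s % 2 = 0), x ^ (s / 2)
        + ∑ s ∈ (Icc 2 n₃).filter (fun s => s % 2 = 0), x ^ (s / 2)
        + ∑ ρ ∈ Icc 1 (min n₂ n₃ / 2),
            ∑ s ∈ (Icc 2 (n₁ - 2 * ρ)).filter (fun s => s % 2 = 0), (x - 1) * x ^ (2 * ρ + s / 2 - 1)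
        + ∑ ρ ∈ Icc 1 (min n₁ n₃ / 2),
            ∑ s ∈ (Icc 2 (n₂ - 2 * ρ)).filter (fun s => s % 2 = 0), (x - 1) * x ^ (2 * ρ + s / 2 - 1)
        + ∑ ρ ∈ Icc 1 (min n₁ n₂ / 2),
            ∑ s ∈ (Icc 2 (n₃ - 2 * ρ)).filter (fun s => s % 2 = 0), (x - 1) * x ^ (2 * ρ + s / 2 - 1)
        + ∑ ρ ∈ (Icc 1 (min n₁ (min n₂ n₃))).filter
              (fun ρ => min n₁ (min n₂ n₃) < 2 * ρ ∧ 2 * ρ - min n₁ (min n₂ n₃) ≤ min n₁ (min n₂ n₃) - d + 1),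
            x ^ (2 * ρ + (max n₁ (max n₂ n₃) - min n₁ (min n₂ n₃)) / 2 - (2 * ρ - min n₁ (min n₂ n₃) + 1) / 2)
        + ∑ ρ ∈ Icc 1 (min n₁ (min n₂ n₃) / 2), (x - 2) * x ^ (2 * ρ - 1))
      = x ^ ((n₁ + n₂ + n₃ - d + 2) / 2) - 1 := by
  have h := stableCountSum_planes x (P := 0) (Nat.zero_le 1) hd hiso hdn h1 h2 h3
  -- on-branch: drop the (odd) index `s = 1`
  have eT : ∀ n, (Icc 1 n).filter (fun s => s % 2 = 0) = (Icc 2 n).filter (fun s => s % 2 = 0) := by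
    intro n; ext s; simp only [mem_filter, mem_Icc]; omega
  -- outer tube / hanging index `r = 2ρ`
  have eG : ∀ (f : ℕ → R) (n' : ℕ), ∑ r ∈ (Icc 1 n').filter (fun r => r % 2 = 0), f r = ∑ ρ ∈ Icc 1 (n' / 2), f (2 * ρ) := by
    intro f n'; rw [sum_filter_even_eq_sum_twice' f 1 n']
  -- glue index `r = 2ρ`
  have eGl : ∀ (f : ℕ → R) (m : ℕ), ∑ r ∈ (Icc (m + 1) (2 * m)).filter (fun r => r % 2 = 0 ∧ r - m ≤ m - d + 1), f r
      = ∑ ρ ∈ (Icc 1 m).filter (fun ρ => m < 2 * ρ ∧ 2 * ρ - m ≤ m - d + 1), f (2 * ρ) := by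
    intro f m
    rw [sum_filter_even_eq_sum_twice f (fun r => r - m ≤ m - d + 1) (m + 1) (2 * m)]
    refine sum_congr ?_ fun _ _ => rfl
    ext ρ; simp only [mem_filter, mem_Icc]; omega
  rw [if_pos rfl, eT n₁, eT n₂, eT n₃, eG _ (min n₂ n₃), eG _ (min n₁ n₃), eG _ (min n₁ n₂),
    eG _ (min n₁ (min n₂ n₃)), eGl _ (min n₁ (min n₂ n₃))] at h
  exact h

/-- **TYPE 0 BOX FORM with the shift hypothesis** `2k + d = n₁ + n₂ + n₃ + 2` (`q : ℕ` cast to `ℚ`; no hypothesis on `q`): `(q − 1)·N₀ = q^k − 1`. [cite: Rogawski1990, §4.9 Prop. 4.9.1 (a) p. 55] -/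
theorem stableCountSum_planes_typeZero_box_of_shift (q : ℕ) {d n₁ n₂ n₃ k : ℕ} (hd : 1 ≤ d)
    (hiso : (n₁ = n₂ ∧ n₁ ≤ n₃) ∨ (n₁ = n₃ ∧ n₁ ≤ n₂) ∨ (n₂ = n₃ ∧ n₂ ≤ n₁))
    (hdn : d ≤ min n₁ (min n₂ n₃)) (h1 : n₁ % 2 = d % 2) (h2 : n₂ % 2 = d % 2) (h3 : n₃ % 2 = d % 2)
    (hk : 2 * k + d = n₁ + n₂ + n₃ + 2) :
    ((q : ℚ) - 1) *
      (1
        + ∑ s ∈ (Icc 2 n₁).filter (fun s => s % 2 = 0), (q : ℚ) ^ (s / 2)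
        + ∑ s ∈ (Icc 2 n₂).filter (fun s => s % 2 = 0), (q : ℚ) ^ (s / 2)
        + ∑ s ∈ (Icc 2 n₃).filter (fun s => s % 2 = 0), (q : ℚ) ^ (s / 2)
        + ∑ ρ ∈ Icc 1 (min n₂ n₃ / 2),
            ∑ s ∈ (Icc 2 (n₁ - 2 * ρ)).filter (fun s => s % 2 = 0), ((q : ℚ) - 1) * (q : ℚ) ^ (2 * ρ + s / 2 - 1)
        + ∑ ρ ∈ Icc 1 (min n₁ n₃ / 2),
            ∑ s ∈ (Icc 2 (n₂ - 2 * ρ)).filter (fun s => s % 2 = 0), ((q : ℚ) - 1) * (q : ℚ) ^ (2 * ρ + s / 2 - 1)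
        + ∑ ρ ∈ Icc 1 (min n₁ n₂ / 2),
            ∑ s ∈ (Icc 2 (n₃ - 2 * ρ)).filter (fun s => s % 2 = 0), ((q : ℚ) - 1) * (q : ℚ) ^ (2 * ρ + s / 2 - 1)
        + ∑ ρ ∈ (Icc 1 (min n₁ (min n₂ n₃))).filter
              (fun ρ => min n₁ (min n₂ n₃) < 2 * ρ ∧ 2 * ρ - min n₁ (min n₂ n₃) ≤ min n₁ (min n₂ n₃) - d + 1),
            (q : ℚ) ^ (2 * ρ + (max n₁ (max n₂ n₃) - min n₁ (min n₂ n₃)) / 2 - (2 * ρ - min n₁ (min n₂ n₃) + 1) / 2)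
        + ∑ ρ ∈ Icc 1 (min n₁ (min n₂ n₃) / 2), ((q : ℚ) - 2) * (q : ℚ) ^ (2 * ρ - 1))
      = (q : ℚ) ^ k - 1 := by
  have h := stableCountSum_planes_typeZero_box (q : ℚ) hd hiso hdn h1 h2 h3
  have hk' : (n₁ + n₂ + n₃ - d + 2) / 2 = k := by omega
  rw [hk'] at h
  exact h

end Box



/-! ## §8  TYPE 2 IN BOX COORDINATES: `r = 2ρ + 1` (`ρ = b = (r−1)/2 ≥ 0`, MEMO v2.1 §T2.1–T2.3), no parity filter on the outer indices -/

section BoxTwo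

variable {R : Type*} [CommRing R]

/-- Re-indexing an odd-filtered interval sum by `r = 2ρ + 1`: `Σ_{a ≤ r ≤ b, r odd, p r} f r = Σ_{⌊a/2⌋ ≤ ρ ≤ ⌊(b−1)/2⌋, a ≤ 2ρ+1, p (2ρ+1)} f (2ρ+1)` — the guard `a ≤ 2ρ + 1` only
matters at `a = 0`; we keep it inside the filter so that the statement needs no side condition. [folklore] -/
theorem sum_filter_odd_eq_sum_twice_add_one (f : ℕ → R) (p : ℕ → Prop) [DecidablePred p] (a b : ℕ) :
    ∑ r ∈ (Icc a b).filter (fun r => r % 2 = 1 ∧ p r), f r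
      = ∑ ρ ∈ (Icc (a / 2) ((b - 1) / 2)).filter (fun ρ => a ≤ 2 * ρ + 1 ∧ 2 * ρ + 1 ≤ b ∧ p (2 * ρ + 1)), f (2 * ρ + 1) := by
  have hinj : Set.InjOn (fun ρ : ℕ => 2 * ρ + 1)
      ↑((Icc (a / 2) ((b - 1) / 2)).filter (fun ρ => a ≤ 2 * ρ + 1 ∧ 2 * ρ + 1 ≤ b ∧ p (2 * ρ + 1))) := by
    intro u _ v _ huv
    have : 2 * u + 1 = 2 * v + 1 := huv
    omega
  rw [← sum_image hinj]
  refine sum_congr ?_ fun _ _ => rfl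
  ext r
  simp only [mem_filter, mem_Icc, mem_image]
  constructor
  · rintro ⟨⟨h1, h2⟩, h3, h4⟩
    refine ⟨r / 2, ⟨⟨by omega, by omega⟩, by omega, by omega, ?_⟩, by omega⟩
    have hr : 2 * (r / 2) + 1 = r := by omega
    rw [hr]; exact h4
  · rintro ⟨ρ, ⟨⟨h1, h2⟩, h3, h4, h5⟩, rfl⟩
    exact ⟨⟨h3, h4⟩, by omega, h5⟩

/-- **«THE SUM», TYPE 2, PER PLANE, IN BOX COORDINATES** (MEMO v2.1 §T2.1–T2.3: the type-2 strata have `r` odd, HNF index `ρ = b = (r−1)/2 ≥ 0`): for an isoceles key `(n₁,n₂,n₃)` in datum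
order, `nᵢ ≡ d (mod 2)`, `1 ≤ d ≤ m := min nᵢ`, `L := max nᵢ`:
`(x−1)·[ Σ_i Σ_{1≤s≤nᵢ, s odd} x^{⌊s/2⌋} + Σ_i Σ_{0≤ρ, 2ρ+1≤min_{j≠i} n_j} Σ_{2≤s≤nᵢ−(2ρ+1), s even} (x−1)x^{2ρ+s/2} + Σ_{ρ: m<2ρ+1≤2m, 2ρ+1−m≤m−d+1} x^{2ρ+1+(L−m)/2−⌈(2ρ+1−m)/2⌉} + Σ_{0≤ρ, 2ρ+1≤m} (x−2)x^{2ρ} ]`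
`= x^{(n₁+n₂+n₃−d+2)/2} − 1` (no core term at type 2).  The monomials are MEMO v2.1's `q^{⌊s/2⌋}` (T, `s` odd), `(q−1)q^{r+s/2−1}` (tube, `r = 2ρ+1`), `q^{r+s_g/2−⌈(r−m)/2⌉}` (glue),
`(q−2)q^{r−1}` (H).  From `stableCountSum_planes` at `P = 1`. [cite: Rogawski1990, §4.9 Prop. 4.9.1 (a) p. 55] -/
theorem stableCountSum_planes_typeTwo_box (x : R) {d n₁ n₂ n₃ : ℕ} (hd : 1 ≤ d)
    (hiso : (n₁ = n₂ ∧ n₁ ≤ n₃) ∨ (n₁ = n₃ ∧ n₁ ≤ n₂) ∨ (n₂ = n₃ ∧ n₂ ≤ n₁))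
    (hdn : d ≤ min n₁ (min n₂ n₃)) (h1 : n₁ % 2 = d % 2) (h2 : n₂ % 2 = d % 2) (h3 : n₃ % 2 = d % 2) :
    (x - 1) *
      (∑ s ∈ (Icc 1 n₁).filter (fun s => s % 2 = 1), x ^ (s / 2)
        + ∑ s ∈ (Icc 1 n₂).filter (fun s => s % 2 = 1), x ^ (s / 2)
        + ∑ s ∈ (Icc 1 n₃).filter (fun s => s % 2 = 1), x ^ (s / 2)
        + ∑ ρ ∈ (Icc 0 (min n₂ n₃)).filter (fun ρ => 2 * ρ + 1 ≤ min n₂ n₃),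
            ∑ s ∈ (Icc 2 (n₁ - (2 * ρ + 1))).filter (fun s => s % 2 = 0), (x - 1) * x ^ (2 * ρ + s / 2)
        + ∑ ρ ∈ (Icc 0 (min n₁ n₃)).filter (fun ρ => 2 * ρ + 1 ≤ min n₁ n₃),
            ∑ s ∈ (Icc 2 (n₂ - (2 * ρ + 1))).filter (fun s => s % 2 = 0), (x - 1) * x ^ (2 * ρ + s / 2)
        + ∑ ρ ∈ (Icc 0 (min n₁ n₂)).filter (fun ρ => 2 * ρ + 1 ≤ min n₁ n₂),
            ∑ s ∈ (Icc 2 (n₃ - (2 * ρ + 1))).filter (fun s => s % 2 = 0), (x - 1) * x ^ (2 * ρ + s / 2)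
        + ∑ ρ ∈ (Icc 0 (min n₁ (min n₂ n₃))).filter
              (fun ρ => min n₁ (min n₂ n₃) < 2 * ρ + 1 ∧ 2 * ρ + 1 ≤ 2 * min n₁ (min n₂ n₃) ∧
                2 * ρ + 1 - min n₁ (min n₂ n₃) ≤ min n₁ (min n₂ n₃) - d + 1),
            x ^ (2 * ρ + 1 + (max n₁ (max n₂ n₃) - min n₁ (min n₂ n₃)) / 2 - (2 * ρ + 1 - min n₁ (min n₂ n₃) + 1) / 2)
        + ∑ ρ ∈ (Icc 0 (min n₁ (min n₂ n₃))).filter (fun ρ => 2 * ρ + 1 ≤ min n₁ (min n₂ n₃)), (x - 2) * x ^ (2 * ρ))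
      = x ^ ((n₁ + n₂ + n₃ - d + 2) / 2) - 1 := by
  have h := stableCountSum_planes x (P := 1) le_rfl hd hiso hdn h1 h2 h3
  -- outer tube / hanging index `r = 2ρ + 1`
  have eG : ∀ (g : ℕ → R) (n' : ℕ), ∑ r ∈ (Icc 1 n').filter (fun r => r % 2 = 1), g r
      = ∑ ρ ∈ (Icc 0 n').filter (fun ρ => 2 * ρ + 1 ≤ n'), g (2 * ρ + 1) := by
    intro g n'
    have h0 := sum_filter_odd_eq_sum_twice_add_one g (fun _ => True) 1 n'
    simp only [and_true] at h0
    rw [h0]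
    refine sum_congr ?_ fun _ _ => rfl
    ext ρ; simp only [mem_filter, mem_Icc]; omega
  -- glue index `r = 2ρ + 1`
  have eGl : ∀ (g : ℕ → R) (m : ℕ), ∑ r ∈ (Icc (m + 1) (2 * m)).filter (fun r => r % 2 = 1 ∧ r - m ≤ m - d + 1), g r
      = ∑ ρ ∈ (Icc 0 m).filter (fun ρ => m < 2 * ρ + 1 ∧ 2 * ρ + 1 ≤ 2 * m ∧ 2 * ρ + 1 - m ≤ m - d + 1), g (2 * ρ + 1) := by
    intro g m
    rw [sum_filter_odd_eq_sum_twice_add_one g (fun r => r - m ≤ m - d + 1) (m + 1) (2 * m)]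
    refine sum_congr ?_ fun _ _ => rfl
    ext ρ; simp only [mem_filter, mem_Icc]; omega
  -- tube and hanging summands: `2ρ + 1 + s/2 − 1 = 2ρ + s/2`, `2ρ + 1 − 1 = 2ρ`
  have eE : ∀ (ρ s : ℕ), 2 * ρ + 1 + s / 2 - 1 = 2 * ρ + s / 2 := by intro ρ s; omega
  have eH : ∀ ρ : ℕ, 2 * ρ + 1 - 1 = 2 * ρ := by intro ρ; omega
  rw [if_neg one_ne_zero, zero_add, eG _ (min n₂ n₃), eG _ (min n₁ n₃), eG _ (min n₁ n₂), eG _ (min n₁ (min n₂ n₃)),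
    eGl _ (min n₁ (min n₂ n₃))] at h
  simp only [eE, eH] at h
  exact h

/-- **TYPE 2 BOX FORM with the shift hypothesis** `2k + d = n₁ + n₂ + n₃ + 2` (`q : ℕ` cast to `ℚ`; no hypothesis on `q`): `(q − 1)·N₂ = q^k − 1`. [cite: Rogawski1990, §4.9 Prop. 4.9.1 (a) p. 55] -/
theorem stableCountSum_planes_typeTwo_box_of_shift (q : ℕ) {d n₁ n₂ n₃ k : ℕ} (hd : 1 ≤ d)
    (hiso : (n₁ = n₂ ∧ n₁ ≤ n₃) ∨ (n₁ = n₃ ∧ n₁ ≤ n₂) ∨ (n₂ = n₃ ∧ n₂ ≤ n₁))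
    (hdn : d ≤ min n₁ (min n₂ n₃)) (h1 : n₁ % 2 = d % 2) (h2 : n₂ % 2 = d % 2) (h3 : n₃ % 2 = d % 2)
    (hk : 2 * k + d = n₁ + n₂ + n₃ + 2) :
    ((q : ℚ) - 1) *
      (∑ s ∈ (Icc 1 n₁).filter (fun s => s % 2 = 1), (q : ℚ) ^ (s / 2)
        + ∑ s ∈ (Icc 1 n₂).filter (fun s => s % 2 = 1), (q : ℚ) ^ (s / 2)
        + ∑ s ∈ (Icc 1 n₃).filter (fun s => s % 2 = 1), (q : ℚ) ^ (s / 2)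
        + ∑ ρ ∈ (Icc 0 (min n₂ n₃)).filter (fun ρ => 2 * ρ + 1 ≤ min n₂ n₃),
            ∑ s ∈ (Icc 2 (n₁ - (2 * ρ + 1))).filter (fun s => s % 2 = 0), ((q : ℚ) - 1) * (q : ℚ) ^ (2 * ρ + s / 2)
        + ∑ ρ ∈ (Icc 0 (min n₁ n₃)).filter (fun ρ => 2 * ρ + 1 ≤ min n₁ n₃),
            ∑ s ∈ (Icc 2 (n₂ - (2 * ρ + 1))).filter (fun s => s % 2 = 0), ((q : ℚ) - 1) * (q : ℚ) ^ (2 * ρ + s / 2)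
        + ∑ ρ ∈ (Icc 0 (min n₁ n₂)).filter (fun ρ => 2 * ρ + 1 ≤ min n₁ n₂),
            ∑ s ∈ (Icc 2 (n₃ - (2 * ρ + 1))).filter (fun s => s % 2 = 0), ((q : ℚ) - 1) * (q : ℚ) ^ (2 * ρ + s / 2)
        + ∑ ρ ∈ (Icc 0 (min n₁ (min n₂ n₃))).filter
              (fun ρ => min n₁ (min n₂ n₃) < 2 * ρ + 1 ∧ 2 * ρ + 1 ≤ 2 * min n₁ (min n₂ n₃) ∧
                2 * ρ + 1 - min n₁ (min n₂ n₃) ≤ min n₁ (min n₂ n₃) - d + 1),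
            (q : ℚ) ^ (2 * ρ + 1 + (max n₁ (max n₂ n₃) - min n₁ (min n₂ n₃)) / 2 - (2 * ρ + 1 - min n₁ (min n₂ n₃) + 1) / 2)
        + ∑ ρ ∈ (Icc 0 (min n₁ (min n₂ n₃))).filter (fun ρ => 2 * ρ + 1 ≤ min n₁ (min n₂ n₃)), ((q : ℚ) - 2) * (q : ℚ) ^ (2 * ρ))
      = (q : ℚ) ^ k - 1 := by
  have h := stableCountSum_planes_typeTwo_box (q : ℚ) hd hiso hdn h1 h2 h3
  have hk' : (n₁ + n₂ + n₃ - d + 2) / 2 = k := by omega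
  rw [hk'] at h
  exact h

end BoxTwo

end Summit.HodgeConjecture.HodgeConjecture.Cruxes.H413.F0P3cDyRamStableCountSumPlanes
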